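import Literature.AnabelianGeometry.SemiGraphs.TemperedReconstructionCor39IsoFiniteVertices
import Literature.AnabelianGeometry.SemiGraphs.TemperedSpecialFibreCuspsReduction
import Literature.AnabelianGeometry.SemiGraphs.TemperedThm37OfCompactInVerticialAt
import Literature.AnabelianGeometry.SemiGraphs.TemperedReconstructionEdgeMapProofs
import Literature.AnabelianGeometry.SemiGraphs.TemperedReconstructionR4Proofs
import Literature.AnabelianGeometry.SemiGraphs.TemperedReconstructionReductionsProofs
import HarnessLib

/-!
# [SemiAnbd] Cor. 3.9 at FINITE graphs, isomorphism version — II: edges, the isomorphism, and the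
# special fibres `G[α] ⥲ G[β]` (proof-only)

Mochizuki, *Semi-graphs of anabelioids*, Publ. RIMS **42** (2006), §3, Cor. 3.9 pp. 42–43 and Cor. 3.11
proof p. 46: "by Corollary 3.9, we conclude that `γ` induces a natural, functorial isomorphism of graphs
of anabelioids `G[α]_Σ ⥲ G[β]_Σ`" [cite: MochizukiSemiAnbd2006, Cor 3.11 p.46].

PROOF-ONLY file (abc-iut cell, layer L3, sub-DAG SemiAnbd-Cor311, row «S3a-ISO», seat abc-iut-w4-d083),
second of two (vertices: `TemperedReconstructionCor39IsoFiniteVertices.lean`).  Same setting, with `F`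
locally open and compatible with the isomorphism `φ` on verticial AND edge homomorphisms:

* `map_range_eq_of_compatE` — `φ(ψ_e(Π_e)) = g · ψ_{F e}(Π_{F e}) · g⁻¹`: `φ(ψ_e(Π_e)) = φ(K₁) ∩ φ(K₂)`
  for the two maximal compact subgroups through the edge-like subgroup (Thm. 3.7 (iv)), and the edge-like
  host `g · L_{F e} · g⁻¹ = K₁' ∩ K₂'` has `K_i' ∈ {φ(K₁), φ(K₂)}` by Thm. 3.7 (iii) (a nontrivial compact
  subgroup lies in at most two verticial subgroups); hence `hE_bijective_of_compat_equiv`;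
* `edgeMap_bijective_of_compat_equiv` — through the bijection `φ` induces on edge-like subgroups of
  closed edges (`EdgeLikeDistinctAt` at the finite graphs);
* `isIso_of_compat_equiv_of_finite` — **`F` is an isomorphism of semi-graphs of anabelioids**;
* `SpecialFibreData.exists_isIso_graphCompatible_of_finite` — for special-fibre data with finite
  semi-graphs, the isomorphism `φ` of the tempered fundamental groups of the special fibres is induced on
  the graphs of anabelioids WITHOUT compact structure by an ISOMORPHISM `F₀ : G[α] ⥲ G[β]` compatible with
  `φ` (print's step, verbatim); `SpecialFibreData.specialFibreIso_of_cuspExtensionIso_of_finite` — so the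
  Cor. 3.11 step (C) (`CuspExtensionUnique`, `TemperedSpecialFibreCusps.lean`) may equally be consumed
  with the printed antecedent `F₀.IsIso`.

No definition; nothing here takes a side on [IUTchIII] Cor. 3.12.
-/

open CategoryTheory Topology

noncomputable section

namespace Literature.AnabelianGeometry.SemiGraphs

universe u

namespace ProfiniteSemiGraph

variable {𝒢 ℋ : ProfiniteSemiGraph.{u}}

/-- **`φ(ψ_e(Π_e)) = g · ψ_{F e}(Π_{F e}) · g⁻¹`** at a (closed) edge `e = e(b)` of the finite graph `G`:
`φ(L_e) = φ(K₁) ∩ φ(K₂)` for the two maximal compact subgroups through `L_e` (Thm. 3.7 (iv)); the edge-like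
host `g · L_{F e} · g⁻¹ = K₁' ∩ K₂'` has `K_i' ∈ {φ(K₁), φ(K₂)}` (Thm. 3.7 (iii): a nontrivial compact
subgroup lies in at most two verticial subgroups), so the inclusion is an equality.
[cite: MochizukiSemiAnbd2006, Cor 3.9 p.43] -/
theorem map_range_eq_of_compatE [Finite 𝒢.graph.Vertex] [Finite 𝒢.graph.Edge]
    [Finite ℋ.graph.Vertex] [Finite ℋ.graph.Edge]
    (h𝒢 : Cor39Hypotheses 𝒢) (hℋ : Cor39Hypotheses ℋ) (c𝒢 : TemperedPiChart 𝒢) (cℋ : TemperedPiChart ℋ)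
    (φ : c𝒢.G ≃ₜ* cℋ.G) (F : Hom 𝒢 ℋ) {b : 𝒢.graph.Branch} {v : 𝒢.graph.Vertex}
    (hb : 𝒢.graph.abuts b = some v) {ψ : 𝒢.Ge (𝒢.graph.edgeOf b) →ₜ* c𝒢.G}
    {ψ' : ℋ.Ge (F.base.edgeMap (𝒢.graph.edgeOf b)) →ₜ* cℋ.G}
    (hψ : IsEdgeHom c𝒢 (𝒢.graph.edgeOf b) ψ)
    (hψ' : IsEdgeHom cℋ (F.base.edgeMap (𝒢.graph.edgeOf b)) ψ') {g : cℋ.G}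
    (hg : ∀ x, φ (ψ x) = g * ψ' (F.hE _ x) * g⁻¹) :
    ψ.toMonoidHom.range.map φ.toMonoidHom = ψ'.toMonoidHom.range.map (MulAut.conj g).toMonoidHom := by
  have h37i := verticialInjective_holds.{u}
  have h𝒢37 := h𝒢.thm37Hypotheses
  have hℋ37 := hℋ.thm37Hypotheses
  have hiv𝒢 := maximalCompactIffVerticialAt_of_finiteGraph h𝒢37 c𝒢
  have hivℋ := maximalCompactIffVerticialAt_of_finiteGraph hℋ37 cℋ
  -- `L = ψ(Π_e)` is a nontrivial edge-like subgroup of a closed edge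
  set L : Subgroup c𝒢.G := ψ.toMonoidHom.range with hLdef
  have hL : L ∈ edgeLikeSubgroups c𝒢 (𝒢.graph.edgeOf b) := ⟨ψ, hψ, rfl⟩
  have hψinj : Function.Injective ψ := injective_of_isEdgeHom h37i h𝒢37 c𝒢 b v hb ψ hψ
  have hL0 : L ≠ ⊥ := by
    intro h0
    apply ne_bot_of_isOpen_ge h𝒢37.toProp36Hypotheses hb (U := ⊤) isOpen_univ
    rw [eq_bot_iff]
    intro x _
    have hx : ψ x ∈ L := ⟨x, rfl⟩
    rw [h0, Subgroup.mem_bot] at hx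
    exact (Subgroup.mem_bot).mpr (hψinj (by rw [hx, map_one]))
  obtain ⟨K₁, K₂, hK₁, hK₂, hne, hLK⟩ :=
    ((hiv𝒢.2 L hL0).mpr ⟨_, isClosedEdge_of_isGraph h𝒢.isGraph _, hL⟩)
  -- its image `φ(L) = φ(K₁) ∩ φ(K₂)`
  have hφL : L.map φ.toMonoidHom = K₁.map φ.toMonoidHom ⊓ K₂.map φ.toMonoidHom := by
    rw [hLK]; exact Subgroup.map_inf_eq K₁ K₂ _ φ.injective
  have hφK₁ := IsMaximalCompactSubgroup.map_equiv φ hK₁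
  have hφK₂ := IsMaximalCompactSubgroup.map_equiv φ hK₂
  have hφne : K₁.map φ.toMonoidHom ≠ K₂.map φ.toMonoidHom :=
    fun h => hne (Subgroup.map_injective φ.injective h)
  have hφL0 : L.map φ.toMonoidHom ≠ ⊥ := by
    rwa [Ne, Subgroup.map_eq_bot_iff_of_injective L φ.injective]
  obtain ⟨w₁, hw₁⟩ := (hivℋ.1 _).mp hφK₁
  obtain ⟨w₂, hw₂⟩ := (hivℋ.1 _).mp hφK₂
  -- the host `M = g · ψ'(Π_{F e}) · g⁻¹` is edge-like of a closed edge and contains `φ(L)`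
  set M : Subgroup cℋ.G := ψ'.toMonoidHom.range.map (MulAut.conj g).toMonoidHom with hMdef
  have hM : M ∈ edgeLikeSubgroups cℋ (F.base.edgeMap (𝒢.graph.edgeOf b)) :=
    conj_mem_edgeLikeSubgroups' cℋ ⟨ψ', hψ', rfl⟩ g
  have hLM : L.map φ.toMonoidHom ≤ M := by
    rintro _ ⟨_, ⟨x, rfl⟩, rfl⟩
    exact ⟨ψ' (F.hE _ x), ⟨F.hE _ x, rfl⟩, (hg x).symm⟩
  have hM0 : M ≠ ⊥ := fun h0 => hφL0 (le_bot_iff.mp (h0 ▸ hLM))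
  obtain ⟨K₁', K₂', hK₁', hK₂', hne', hMK⟩ :=
    ((hivℋ.2 M hM0).mpr ⟨_, isClosedEdge_of_isGraph hℋ.isGraph _, hM⟩)
  obtain ⟨w₁', hw₁'⟩ := (hivℋ.1 _).mp hK₁'
  obtain ⟨w₂', hw₂'⟩ := (hivℋ.1 _).mp hK₂'
  -- Thm 3.7 (iii): `φ(L)` lies in no third verticial subgroup
  have hLc : IsCompact ((L.map φ.toMonoidHom : Subgroup cℋ.G) : Set cℋ.G) := by
    rw [coe_map_continuousMulEquiv]
    exact φ.toHomeomorph.isCompact_image.mpr (isCompact_of_mem_edgeLikeSubgroups c𝒢 hL)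
  have hthird := ((compactInVerticialAt_of_finiteGraph hℋ37 cℋ _ hLc).2 hφL0 w₁ w₂ _ _ hw₁ hw₂ hφne
    (hφL ▸ inf_le_left) (hφL ▸ inf_le_right)).1
  have h1 := hthird w₁' K₁' hw₁' (le_trans hLM (hMK ▸ inf_le_left))
  have h2 := hthird w₂' K₂' hw₂' (le_trans hLM (hMK ▸ inf_le_right))
  have hMeq : M = L.map φ.toMonoidHom := by
    rw [hMK, hφL]
    rcases h1 with rfl | rfl <;> rcases h2 with rfl | rfl
    · exact absurd rfl hne'
    · rfl
    · exact inf_comm _ _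
    · exact absurd rfl hne'
  exact hMeq.symm

/-- **The edge homomorphisms `F_e` are bijective.** [cite: MochizukiSemiAnbd2006, Cor 3.11 p.46] -/
theorem hE_bijective_of_compat_equiv [Finite 𝒢.graph.Vertex] [Finite 𝒢.graph.Edge]
    [Finite ℋ.graph.Vertex] [Finite ℋ.graph.Edge]
    (h𝒢 : Cor39Hypotheses 𝒢) (hℋ : Cor39Hypotheses ℋ) (c𝒢 : TemperedPiChart 𝒢) (cℋ : TemperedPiChart ℋ)
    (φ : c𝒢.G ≃ₜ* cℋ.G) (F : Hom 𝒢 ℋ) (hE : F.CompatE c𝒢 cℋ (φ : c𝒢.G →ₜ* cℋ.G))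
    (e : 𝒢.graph.Edge) : Function.Bijective (F.hE e) := by
  have h37i := verticialInjective_holds.{u}
  obtain ⟨b, -, -, hbe, -, -⟩ := 𝒢.graph.two_branches e
  subst hbe
  obtain ⟨v, hb⟩ := Option.isSome_iff_exists.mp (h𝒢.isGraph.abuts_isSome b)
  obtain ⟨ψ, hψ, hψinj⟩ := exists_isEdgeHom_injective h37i h𝒢.thm37Hypotheses c𝒢 b v hb
  -- an injective edge homomorphism at `F e`
  have hex' : ∃ ψ' : ℋ.Ge (F.base.edgeMap (𝒢.graph.edgeOf b)) →ₜ* cℋ.G,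
      IsEdgeHom cℋ (F.base.edgeMap (𝒢.graph.edgeOf b)) ψ' ∧ Function.Injective ψ' := by
    rw [← F.base.edgeOf_branchMap b]
    exact exists_isEdgeHom_injective h37i hℋ.thm37Hypotheses cℋ (F.base.branchMap b)
      (F.base.vertexMap v) (F.base.abuts_branchMap b v hb)
  obtain ⟨ψ', hψ', hψ'inj⟩ := hex'
  obtain ⟨g, hg⟩ := hE _ ψ ψ' hψ hψ'
  have hg' : ∀ x, φ (ψ x) = g * ψ' (F.hE _ x) * g⁻¹ := fun x => hg x
  refine ⟨fun x y hxy => hψinj ?_, fun y => ?_⟩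
  · apply φ.injective
    rw [hg' x, hg' y, hxy]
  · have hmem : g * ψ' y * g⁻¹ ∈ ψ'.toMonoidHom.range.map (MulAut.conj g).toMonoidHom :=
      ⟨ψ' y, ⟨y, rfl⟩, rfl⟩
    rw [← map_range_eq_of_compatE h𝒢 hℋ c𝒢 cℋ φ F hb hψ hψ' hg'] at hmem
    obtain ⟨_, ⟨x, rfl⟩, hx⟩ := hmem
    refine ⟨x, hψ'inj ?_⟩
    have h1 : φ (ψ x) = g * ψ' y * g⁻¹ := hx
    rw [hg' x] at h1
    exact mul_left_cancel (mul_right_cancel h1)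

/-- **The edge map of `F` is bijective** (through the bijection `φ` induces on edge-like subgroups of
closed edges, Thm. 3.7 (iv) + `EdgeLikeDistinctAt` at the finite graphs).
[cite: MochizukiSemiAnbd2006, Cor 3.11 p.46] -/
theorem edgeMap_bijective_of_compat_equiv [Finite 𝒢.graph.Vertex] [Finite 𝒢.graph.Edge]
    [Finite ℋ.graph.Vertex] [Finite ℋ.graph.Edge]
    (h𝒢 : Cor39Hypotheses 𝒢) (hℋ : Cor39Hypotheses ℋ) (c𝒢 : TemperedPiChart 𝒢) (cℋ : TemperedPiChart ℋ)
    (φ : c𝒢.G ≃ₜ* cℋ.G) (F : Hom 𝒢 ℋ) (hE : F.CompatE c𝒢 cℋ (φ : c𝒢.G →ₜ* cℋ.G)) :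
    Function.Bijective F.base.edgeMap := by
  have h37i := verticialInjective_holds.{u}
  have h𝒢37 := h𝒢.thm37Hypotheses
  have hℋ37 := hℋ.thm37Hypotheses
  have hED𝒢 := edgeLikeDistinctAt_of_compactInVerticialAt (compactInVerticialAt_of_finiteGraph (𝒢 := 𝒢)) h𝒢37 c𝒢
  have hEDℋ := edgeLikeDistinctAt_of_compactInVerticialAt (compactInVerticialAt_of_finiteGraph (𝒢 := ℋ)) hℋ37 cℋ
  -- an injective edge homomorphism at every edge of `G`, `H` (graphs: a branch abuts)
  have hedge𝒢 : ∀ e : 𝒢.graph.Edge, ∃ (b : 𝒢.graph.Branch) (v : 𝒢.graph.Vertex),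
      𝒢.graph.edgeOf b = e ∧ 𝒢.graph.abuts b = some v := fun e => by
    obtain ⟨b, -, -, hbe, -, -⟩ := 𝒢.graph.two_branches e
    obtain ⟨v, hb⟩ := Option.isSome_iff_exists.mp (h𝒢.isGraph.abuts_isSome b)
    exact ⟨b, v, hbe, hb⟩
  have hedgeℋ : ∀ f : ℋ.graph.Edge, ∃ ψ' : ℋ.Ge f →ₜ* cℋ.G, IsEdgeHom cℋ f ψ' ∧ Function.Injective ψ' :=
    fun f => by
    obtain ⟨b, -, -, hbe, -, -⟩ := ℋ.graph.two_branches f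
    obtain ⟨w, hb⟩ := Option.isSome_iff_exists.mp (hℋ.isGraph.abuts_isSome b)
    subst hbe
    exact exists_isEdgeHom_injective h37i hℋ37 cℋ b w hb
  -- the equality of (d) at every edge of `G`, packaged
  have key : ∀ (b : 𝒢.graph.Branch) (v : 𝒢.graph.Vertex), 𝒢.graph.abuts b = some v →
      ∃ (ψ : 𝒢.Ge (𝒢.graph.edgeOf b) →ₜ* c𝒢.G) (ψ' : ℋ.Ge (F.base.edgeMap (𝒢.graph.edgeOf b)) →ₜ* cℋ.G)
        (g : cℋ.G), IsEdgeHom c𝒢 _ ψ ∧ IsEdgeHom cℋ _ ψ' ∧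
        ψ.toMonoidHom.range.map φ.toMonoidHom = ψ'.toMonoidHom.range.map (MulAut.conj g).toMonoidHom := by
    intro b v hb
    obtain ⟨ψ, hψ, -⟩ := exists_isEdgeHom_injective h37i h𝒢37 c𝒢 b v hb
    obtain ⟨ψ', hψ', -⟩ := hedgeℋ (F.base.edgeMap (𝒢.graph.edgeOf b))
    obtain ⟨g, hg⟩ := hE _ ψ ψ' hψ hψ'
    exact ⟨ψ, ψ', g, hψ, hψ', map_range_eq_of_compatE h𝒢 hℋ c𝒢 cℋ φ F hb hψ hψ' (fun x => hg x)⟩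
  refine ⟨fun e e' hee => ?_, fun f => ?_⟩
  · obtain ⟨b, v, hbe, hb⟩ := hedge𝒢 e
    obtain ⟨b', v', hbe', hb'⟩ := hedge𝒢 e'
    subst hbe; subst hbe'
    obtain ⟨ψ, ψ', g, hψ, hψ', h1⟩ := key b v hb
    obtain ⟨ψ₁, ψ'₁, g₁, hψ₁, hψ'₁, h2⟩ := key b' v' hb'
    have hmem : ψ'₁.toMonoidHom.range ∈ edgeLikeSubgroups cℋ (F.base.edgeMap (𝒢.graph.edgeOf b)) := by
      rw [hee]; exact ⟨ψ'₁, hψ'₁, rfl⟩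
    obtain ⟨d, hd⟩ := exists_conj_of_mem_edgeLikeSubgroups cℋ ⟨ψ', hψ', rfl⟩ hmem
    have h3 : ψ₁.toMonoidHom.range.map φ.toMonoidHom =
        (ψ.toMonoidHom.range.map φ.toMonoidHom).map (MulAut.conj (g₁ * d * g⁻¹)).toMonoidHom := by
      rw [h1, h2, hd, map_conj_map_conj, map_conj_map_conj]
      congr 2
      group
    have h4 : ψ₁.toMonoidHom.range =
        ψ.toMonoidHom.range.map (MulAut.conj (φ.symm (g₁ * d * g⁻¹))).toMonoidHom := by
      have := congrArg (Subgroup.map φ.symm.toMonoidHom) h3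
      rwa [map_symm_map_equiv, map_symm_conj_map_equiv] at this
    have hL₁e : ψ₁.toMonoidHom.range ∈ edgeLikeSubgroups c𝒢 (𝒢.graph.edgeOf b) := by
      rw [h4]; exact conj_mem_edgeLikeSubgroups' c𝒢 ⟨ψ, hψ, rfl⟩ _
    have hL₁e' : ψ₁.toMonoidHom.range ∈ edgeLikeSubgroups c𝒢 (𝒢.graph.edgeOf b') := ⟨ψ₁, hψ₁, rfl⟩
    by_contra hne
    have h0 := hED𝒢 _ _ _ _ hL₁e hL₁e' hne
    rw [Subgroup.relIndex_self] at h0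
    exact one_ne_zero h0
  · have hiv𝒢 := maximalCompactIffVerticialAt_of_finiteGraph h𝒢37 c𝒢
    have hivℋ := maximalCompactIffVerticialAt_of_finiteGraph hℋ37 cℋ
    obtain ⟨ψf, hψf, hψfinj⟩ := hedgeℋ f
    set Lf : Subgroup cℋ.G := ψf.toMonoidHom.range with hLfdef
    have hLf : Lf ∈ edgeLikeSubgroups cℋ f := ⟨ψf, hψf, rfl⟩
    have hLf0 : Lf ≠ ⊥ := by
      obtain ⟨b, -, -, hbe, -, -⟩ := ℋ.graph.two_branches f
      obtain ⟨w, hb⟩ := Option.isSome_iff_exists.mp (hℋ.isGraph.abuts_isSome b)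
      subst hbe
      intro h0
      apply ne_bot_of_isOpen_ge hℋ37.toProp36Hypotheses hb (U := ⊤) isOpen_univ
      rw [eq_bot_iff]
      intro x _
      have hx : ψf x ∈ Lf := ⟨x, rfl⟩
      rw [h0, Subgroup.mem_bot] at hx
      exact (Subgroup.mem_bot).mpr (hψfinj (by rw [hx, map_one]))
    obtain ⟨K₁', K₂', hK₁', hK₂', hne', hLfK⟩ :=
      ((hivℋ.2 Lf hLf0).mpr ⟨_, isClosedEdge_of_isGraph hℋ.isGraph _, hLf⟩)
    -- pull back: `φ⁻¹(L_f)` is a nontrivial intersection of two distinct maximal compact subgroups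
    have hφLf : Lf.map φ.symm.toMonoidHom =
        K₁'.map φ.symm.toMonoidHom ⊓ K₂'.map φ.symm.toMonoidHom := by
      rw [hLfK]; exact Subgroup.map_inf_eq K₁' K₂' _ φ.symm.injective
    have hφLf0 : Lf.map φ.symm.toMonoidHom ≠ ⊥ := by
      rwa [Ne, Subgroup.map_eq_bot_iff_of_injective Lf φ.symm.injective]
    obtain ⟨e, -, he⟩ := (hiv𝒢.2 _ hφLf0).mp ⟨_, _, IsMaximalCompactSubgroup.map_equiv φ.symm hK₁',
      IsMaximalCompactSubgroup.map_equiv φ.symm hK₂',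
      fun h => hne' (Subgroup.map_injective φ.symm.injective h), hφLf⟩
    -- compare with the edge-like subgroup of `e` and its image
    obtain ⟨b, v, hbe, hb⟩ := hedge𝒢 e
    subst hbe
    obtain ⟨ψ, ψ', g, hψ, hψ', h1⟩ := key b v hb
    obtain ⟨a, ha⟩ := exists_conj_of_mem_edgeLikeSubgroups c𝒢 ⟨ψ, hψ, rfl⟩ he
    have h2 : Lf = ψ'.toMonoidHom.range.map (MulAut.conj (φ a * g)).toMonoidHom := by
      rw [← map_map_symm_equiv φ Lf, ha, map_conj_map_equiv, h1, map_conj_map_conj]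
    have hLf' : Lf ∈ edgeLikeSubgroups cℋ (F.base.edgeMap (𝒢.graph.edgeOf b)) := by
      rw [h2]; exact conj_mem_edgeLikeSubgroups' cℋ ⟨ψ', hψ', rfl⟩ _
    refine ⟨𝒢.graph.edgeOf b, ?_⟩
    by_contra hne
    have h0 := hEDℋ _ _ _ _ hLf' hLf hne
    rw [Subgroup.relIndex_self] at h0
    exact one_ne_zero h0

/-- **Cor. 3.9 at finite graphs, ISOMORPHISM version**: a locally open morphism of graphs of anabelioids
`F : G → H` compatible on verticial and edge homomorphisms with an ISOMORPHISM `φ` of the tempered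
fundamental groups is an isomorphism of semi-graphs of anabelioids (print p. 46: "`γ` induces a
natural, functorial isomorphism of graphs of anabelioids"). [cite: MochizukiSemiAnbd2006, Cor 3.11 p.46] -/
theorem isIso_of_compat_equiv_of_finite [Finite 𝒢.graph.Vertex] [Finite 𝒢.graph.Edge]
    [Finite ℋ.graph.Vertex] [Finite ℋ.graph.Edge]
    (h𝒢 : Cor39Hypotheses 𝒢) (hℋ : Cor39Hypotheses ℋ) (c𝒢 : TemperedPiChart 𝒢) (cℋ : TemperedPiChart ℋ)
    (φ : c𝒢.G ≃ₜ* cℋ.G) (F : Hom 𝒢 ℋ) (hV : F.CompatV c𝒢 cℋ (φ : c𝒢.G →ₜ* cℋ.G))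
    (hE : F.CompatE c𝒢 cℋ (φ : c𝒢.G →ₜ* cℋ.G)) : F.IsIso where
  bijective_vertexMap := vertexMap_bijective_of_compatV_equiv h𝒢 hℋ c𝒢 cℋ φ F hV
  bijective_edgeMap := edgeMap_bijective_of_compat_equiv h𝒢 hℋ c𝒢 cℋ φ F hE
  abuts_none b hb := by
    have := h𝒢.isGraph.abuts_isSome b
    rw [hb] at this
    exact absurd this (by simp)
  isLocallyTrivial := ⟨hV_bijective_of_compatV_equiv h𝒢 hℋ c𝒢 cℋ φ F hV,
    hE_bijective_of_compat_equiv h𝒢 hℋ c𝒢 cℋ φ F hE⟩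

end ProfiniteSemiGraph

/-! ### At the special fibres: `γ` induces an ISOMORPHISM of graphs of anabelioids `G[α] ⥲ G[β]` -/

namespace SpecialFibreData

open ProfiniteSemiGraph

variable {Kα : Type u} [Field Kα] {Kβ : Type u} [Field Kβ]
  {Dα : TemperedArithmeticGroup Kα} {Dβ : TemperedArithmeticGroup Kβ}
  (Sα : SpecialFibreData Dα) (Sβ : SpecialFibreData Dβ)

/-- **(S3a) as printed**: for special-fibre data with FINITE semi-graphs, an isomorphism `φ` of the
tempered fundamental groups of the special fibres is induced on the graphs of anabelioids WITHOUT compact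
structure by an ISOMORPHISM `F₀ : G[α] ⥲ G[β]` compatible with `φ` on verticial and edge homomorphisms
(p. 46 "by Corollary 3.9, we conclude that `γ` induces a natural, functorial isomorphism of graphs of
anabelioids `G[α]_Σ ⥲ G[β]_Σ`"). [cite: MochizukiSemiAnbd2006, Cor 3.11 p.46] -/
theorem exists_isIso_graphCompatible_of_finite [Finite Sα.Gc.graph.Vertex] [Finite Sα.Gc.graph.Edge]
    [Finite Sβ.Gc.graph.Vertex] [Finite Sβ.Gc.graph.Edge] (φ : Sα.chart.G ≃ₜ* Sβ.chart.G) :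
    ∃ F₀ : Hom Sα.graph Sβ.graph, F₀.IsIso ∧ Sα.GraphCompatible Sβ φ F₀ := by
  haveI := Sα.finite_graph_vertex; haveI := Sα.finite_graph_edge
  haveI := Sβ.finite_graph_vertex; haveI := Sβ.finite_graph_edge
  obtain ⟨F₀, -, hc⟩ := Sα.exists_isLocallyOpen_graphCompatible_of_finite Sβ φ
  have hα := Sα.hyp.toProp36Hypotheses.maximalSubgraph_isCuspOmission
  have hβ := Sβ.hyp.toProp36Hypotheses.maximalSubgraph_isCuspOmission
  haveI := isEquivalence_btempRestrict hα
  haveI := isEquivalence_btempRestrict hβ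
  let eα := (Sα.Gc.btempRestrict Sα.Gc.graph.maximalSubgraph).asEquivalence
  let eβ := (Sβ.Gc.btempRestrict Sβ.Gc.graph.maximalSubgraph).asEquivalence
  let cα : TemperedPiChart Sα.graph := Sα.chart.transport eα.symm
  let cβ : TemperedPiChart Sβ.graph := Sβ.chart.transport eβ.symm
  have hV : F₀.CompatV cα cβ (φ : Sα.chart.G →ₜ* Sβ.chart.G) := fun v ψ ψ' hψ hψ' =>
    hc.1 v ψ ψ' hψ hψ'
  have hE : F₀.CompatE cα cβ (φ : Sα.chart.G →ₜ* Sβ.chart.G) := fun e ψ ψ' hψ hψ' =>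
    hc.2 e ψ ψ' hψ hψ'
  exact ⟨F₀, isIso_of_compat_equiv_of_finite Sα.cor39Hypotheses_graph Sβ.cor39Hypotheses_graph cα cβ φ
    F₀ hV hE, hc⟩

/-- **(S3′) at a FINITE pair from the existence clause of (C) restricted to ISOMORPHISMS `F₀`** (the
printed reading of (C): the isomorphism `G[α] ⥲ G[β]` induced by `γ` extends to `G^c[α] ⥲ G^c[β]`).
[cite: MochizukiSemiAnbd2006, Cor 3.11 pp.46-47] -/
theorem specialFibreIso_of_cuspExtensionIso_of_finite [Finite Sα.Gc.graph.Vertex]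
    [Finite Sα.Gc.graph.Edge] [Finite Sβ.Gc.graph.Vertex] [Finite Sβ.Gc.graph.Edge]
    (φ : Sα.chart.G ≃ₜ* Sβ.chart.G)
    (hC : ∀ F₀ : Hom Sα.graph Sβ.graph, F₀.IsIso → Sα.GraphCompatible Sβ φ F₀ →
      ∃ F : Hom Sα.Gc Sβ.Gc, F.IsIso ∧ F.ExtendsBase F₀ ∧ Sα.ChartCompatible Sβ φ F) :
    ∃ F : Hom Sα.Gc Sβ.Gc, F.IsIso ∧ Sα.ChartCompatible Sβ φ F ∧
      ∀ F' : Hom Sα.Gc Sβ.Gc, F'.IsIso → Sα.ChartCompatible Sβ φ F' →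
        F'.base.vertexMap = F.base.vertexMap ∧ F'.base.edgeMap = F.base.edgeMap := by
  obtain ⟨F₀, hF₀, hc⟩ := Sα.exists_isIso_graphCompatible_of_finite Sβ φ
  obtain ⟨F, hF, -, hcF⟩ := hC F₀ hF₀ hc
  exact ⟨F, hF, hcF, fun F' hF' hc' => Sα.chartCompatible_base_maps_unique Sβ φ hF hF' hcF hc'⟩

end SpecialFibreData

end Literature.AnabelianGeometry.SemiGraphs

end
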